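import Summits.NavierStokesRegularity.NavierStokesRegularity.Theorems.PerpetualPumpCircuitPumpTrailBondsDeep
import Summits.NavierStokesRegularity.NavierStokesRegularity.Theorems.PerpetualPumpCircuitPumpPrecursorTower
import Summits.NavierStokesRegularity.NavierStokesRegularity.Theorems.PerpetualPumpCircuitPumpActiveClock

/-!
# `PerpetualPump.CircuitPump` (stmt-NavierStokesRegularity-1834), line `singular-clock-gspt`:
# INTO for the Toda clock box — trail and precursor boxes at a section time

Helper lemmas for the sub-goal `toda_into` of `stub_clockBox` (Toda `m = 2` instance). At a section
time `T` every renormalised mode `q · (mode n+1)` (`q = lam^{1/5}`) must land in the box of scale `n`.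
TRAIL (`n ≤ -1`): `toda_trail_slaving` / `toda_trail_bonds_deep` on `[0, Tmax]` with `ρ̄ = R₀ = 13`,
`σ̄ = (40/A₁) e^{κ Tmax/(1-r)}` give `|a(-j)(T)| ≤ 13 qʲ (2 - rʲ) + 13 (1-r) qʲ rʲ = 13 qʲ (2 - r^{j+1})`
— exactly the carrier box one scale down after multiplying by `q` — and bonds
`b(-j)(T) ≤ (40/A₁) qʲ e^{E_j} (1 + 16.9 ε A₁ r^{j-1} T) e^{65 r^{j-1} T} ≤ (40/A₁) qʲ e^{E_{j+1}}` by the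
design `E_{j+1} - E_j = κ Tmax r^{j-1}` of the bond boxes (`κ = 65 + 16.9 ε A₁`, `r = lam^{-4/5}`); the
spent active pair uses `|u| ≤ 13 ≤ 13 q (2 - r)/q`, `v ≤ 31/A ≤ 40/A₁`. PRECURSORS (`n ≥ 2`): from the
outputs of `toda_precursor_tower` / `toda_precursor_signed` with `β = ε^{3/2}` and the flux budget
`q (ε²/(4 lam²) + lam Zs² Tmax + 28 ε³ Tmax) ≤ ε^{3/4}`. Pure real analysis. [folklore]
-/

set_option linter.dupNamespace false

noncomputable section

open Set

namespace Summit.NavierStokesRegularity.NavierStokesRegularity.Theorems.PerpetualPumpCircuitPump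

/-- **Trail environment of the clock box.** `toda_trail_slaving` and `toda_trail_bonds_deep` on
`[0, Tmax]` with `ρ̄ = R₀ = 13`, `σ̄ = (40/A₁) exp(κ Tmax/(1-r))`, the trail data of the box read in
depth form `j = -n`, and the smallness `2 (σ̄ + 676 ε Tmax)² e^{130 Tmax} Tmax ≤ 13 (1 - r) ≤ 13/2`.
[folklore] -/
theorem into_trail_apply {lam r ε A₁ Tmax κ σb : ℝ} {L : ℕ} {a b : ℤ → ℝ → ℝ} (hlam : 1 < lam)
    (hlam2 : lam ≤ 3 / 2) (hr : r = lam ^ (-(4 / 5 : ℝ))) (hε : 0 ≤ ε) (hε1 : ε ≤ 1)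
    (hTmax : 0 < Tmax) (hTmax2 : Tmax ≤ 1 / 2) (hA₁ : 0 < A₁) (hκ : κ = 65 + 169 / 10 * ε * A₁)
    (hσb : σb = 40 / A₁ * Real.exp (κ * Tmax / (1 - r)))
    (HS5 : 2 * (σb + 4 * ε * 169 * Tmax) ^ 2 * Real.exp (130 * Tmax) * Tmax ≤ 13 * (1 - r))
    (hzero : ∀ n : ℤ, (L : ℤ) < |n| → ∀ t ∈ Icc 0 Tmax, a n t = 0 ∧ b n t = 0)
    (hcont : ∀ n : ℤ, |n| ≤ (L : ℤ) →
      ContinuousOn (a n) (Icc 0 Tmax) ∧ ContinuousOn (b n) (Icc 0 Tmax))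
    (hderiv : ∀ n : ℤ, |n| ≤ (L : ℤ) → ∀ t ∈ Ico 0 Tmax,
      HasDerivWithinAt (a n) (-(lam ^ ((4 / 5 : ℝ) * n)) * a n t - lam ^ (n : ℝ) * b n t ^ 2 +
        lam ^ ((n : ℝ) - 1) * b (n - 1) t ^ 2 - ε * lam ^ (n : ℝ) * a n t * b n t) (Ici t) t ∧
      HasDerivWithinAt (b n) (-(lam ^ ((4 / 5 : ℝ) * n)) * b n t +
        lam ^ (n : ℝ) * b n t * (a n t - a (n + 1) t) + ε * lam ^ (n : ℝ) * a n t ^ 2) (Ici t) t)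
    (hb0 : ∀ n : ℤ, 0 ≤ b n 0) (hu : ∀ t ∈ Icc 0 Tmax, -13 ≤ a 0 t)
    (htrail : ∀ n : ℤ, n ≤ -1 →
      |a n 0| ≤ 13 * lam ^ (-(n : ℝ) / 5) * (2 - lam ^ ((4 / 5 : ℝ) * n)) ∧
      b n 0 ≤ 40 / A₁ * lam ^ (-(n : ℝ) / 5) *
        Real.exp (κ * Tmax * (1 - lam ^ ((4 / 5 : ℝ) * (n + 1))) / (1 - r))) :
    ∀ t ∈ Icc 0 Tmax,
      (∀ j : ℕ, 1 ≤ j → 0 ≤ b (-(j : ℤ)) t ∧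
        b (-(j : ℤ)) t ≤ (b (-(j : ℤ)) 0 + 4 * ε * 169 * lam ^ ((j : ℝ) / 5) * t) * Real.exp (65 * t) ∧
        |a (-(j : ℤ)) t| ≤ |a (-(j : ℤ)) 0| + 2 * (σb + 4 * ε * 169 * Tmax) ^ 2 *
          Real.exp (130 * Tmax) * lam ^ ((j : ℝ) / 5) * lam ^ (-(4 / 5 : ℝ) * j) * t) ∧
      (∀ j : ℕ, 2 ≤ j → b (-(j : ℤ)) t ≤ (b (-(j : ℤ)) 0 +
        4 * ε * 169 * lam ^ ((j : ℝ) / 5) * lam ^ (-(4 / 5 : ℝ) * j) * t) *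
          Real.exp (52 * lam ^ (-(4 / 5 : ℝ) * j) * t)) := by
  intro t ht
  have hlam0 : 0 < lam := by linarith
  have hr1 : r < 1 := by rw [hr]; exact Real.rpow_lt_one_of_one_lt_of_neg hlam (by norm_num)
  have hr12 : 1 / 2 ≤ r := by
    rw [hr, Real.rpow_neg hlam0.le, ← one_div]
    apply div_le_div_of_nonneg_left zero_le_one (by positivity)
    calc lam ^ (4 / 5 : ℝ) ≤ lam ^ (1 : ℝ) := Real.rpow_le_rpow_of_exponent_le hlam.le (by norm_num)
      _ ≤ 2 := by rw [Real.rpow_one]; linarith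
  have hσb0 : 0 ≤ σb := by rw [hσb]; positivity
  have c1 : (4 : ℝ) * 13 + 13 = 65 := by norm_num
  have c2 : (13 : ℝ) ^ 2 = 169 := by norm_num
  have c3 : (2 : ℝ) * (4 * 13 + 13) = 130 := by norm_num
  have c4 : (4 : ℝ) * 13 = 52 := by norm_num
  have hsmall : 2 * (σb + 4 * ε * 13 ^ 2 * Tmax) ^ 2 * Real.exp (2 * (4 * 13 + 13) * Tmax) * Tmax ≤
      13 / 2 := by
    rw [c3, c2]; linarith
  have hdata : ∀ j : ℕ, 1 ≤ j →
      |a (-(j : ℤ)) 0| ≤ 13 * lam ^ ((j : ℝ) / 5) * (2 - lam ^ (-(4 / 5 : ℝ) * j)) ∧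
      b (-(j : ℤ)) 0 ≤ σb * lam ^ ((j : ℝ) / 5) := by
    intro j hj
    obtain ⟨h1, h2⟩ := htrail (-(j : ℤ)) (by omega)
    have e1 : (-((-(j : ℤ) : ℤ) : ℝ) / 5) = (j : ℝ) / 5 := by push_cast; ring
    have e2 : (4 / 5 : ℝ) * ((-(j : ℤ) : ℤ) : ℝ) = -(4 / 5 : ℝ) * j := by push_cast; ring
    rw [e1, e2] at h1
    rw [e1] at h2
    refine ⟨h1, h2.trans ?_⟩
    rw [hσb, mul_right_comm]
    refine mul_le_mul_of_nonneg_right (mul_le_mul_of_nonneg_left (Real.exp_le_exp.mpr ?_)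
      (by positivity)) (by positivity)
    apply div_le_div_of_nonneg_right _ (by linarith)
    have hP : 0 < lam ^ ((4 / 5 : ℝ) * (((-(j : ℤ) : ℤ) : ℝ) + 1)) := by positivity
    have hκ0 : 0 ≤ κ * Tmax := by rw [hκ]; positivity
    linarith [mul_nonneg hκ0 hP.le]
  have hs := toda_trail_slaving lam ε Tmax 13 13 σb L a b hlam (by linarith) hε hε1 hTmax hTmax2
    (by norm_num) (by norm_num) hσb0 hsmall hzero hcont hderiv hb0 hu hdata t ht
  have hd := toda_trail_bonds_deep lam ε Tmax 13 13 σb L a b hlam (by linarith) hε hε1 hTmax hTmax2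
    (by norm_num) (by norm_num) hσb0 hsmall hzero hcont hderiv hb0 hu hdata t ht
  rw [c3, c1, c2] at hs
  rw [c4, c2] at hd
  exact ⟨hs, hd⟩

/-- One step of the bond-box design: a bound `B ≤ (B₀ + X) e^{Y}` with `X ≤ 676 ε Q P₁ T`,
`Y ≤ 65 P₁ T`, `P₁ ≤ P' ≤ 1`, and `B₀ ≤ (40/A₁) Q e^{κ Tmax (1-P')/(1-r)}` give
`B ≤ (40/A₁) Q e^{κ Tmax (1-P)/(1-r)}` for `P = r P'` (`κ = 65 + 16.9 ε A₁`), because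
`κ Tmax (1-P')/(1-r) + κ P' Tmax = κ Tmax (1-P)/(1-r)` and `1 + x ≤ eˣ`. [folklore] -/
theorem into_pt_bond {B B0 X Y ε A₁ Q P P₁ P' r T Tmax κ : ℝ} (hA₁ : 0 < A₁) (hε : 0 ≤ ε)
    (hQ : 0 ≤ Q) (hP₁0 : 0 ≤ P₁) (hP₁ : P₁ ≤ P') (hP'1 : P' ≤ 1) (hrP : r * P' = P) (hr : r < 1)
    (hT0 : 0 ≤ T) (hT : T ≤ Tmax) (hκ : κ = 65 + 169 / 10 * ε * A₁)
    (hX : X ≤ 4 * ε * 169 * Q * P₁ * T) (hY : Y ≤ 65 * P₁ * T) (hB : B ≤ (B0 + X) * Real.exp Y)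
    (hB0' : B0 ≤ 40 / A₁ * Q * Real.exp (κ * Tmax * (1 - P') / (1 - r))) :
    B ≤ 40 / A₁ * Q * Real.exp (κ * Tmax * (1 - P) / (1 - r)) := by
  set E := Real.exp (κ * Tmax * (1 - P') / (1 - r)) with hE
  have hκ0 : 0 ≤ κ := by rw [hκ]; positivity
  have hTmax0 : 0 ≤ Tmax := hT0.trans hT
  have hE1 : 1 ≤ E :=
    Real.one_le_exp (div_nonneg (mul_nonneg (mul_nonneg hκ0 hTmax0) (by linarith)) (by linarith))
  have hc0 : 0 ≤ 40 / A₁ * Q := by positivity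
  set x := 169 / 10 * ε * A₁ * P₁ * T with hx
  have hx0 : 0 ≤ x := by positivity
  have hX' : X ≤ 40 / A₁ * Q * x := by
    have e : 40 / A₁ * Q * x = 4 * ε * 169 * Q * P₁ * T := by rw [hx]; field_simp; ring
    rw [e]; exact hX
  have h1 : B0 + X ≤ 40 / A₁ * Q * E * (1 + x) := by
    have h : 40 / A₁ * Q * x ≤ 40 / A₁ * Q * E * x := by
      have := mul_le_mul_of_nonneg_left hE1 (mul_nonneg hc0 hx0)
      nlinarith
    nlinarith
  have h2 : 1 + x ≤ Real.exp x := by linarith [Real.add_one_le_exp x]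
  have h3 : B ≤ 40 / A₁ * Q * E * Real.exp x * Real.exp Y := by
    calc B ≤ (B0 + X) * Real.exp Y := hB
      _ ≤ (40 / A₁ * Q * E * (1 + x)) * Real.exp Y :=
          mul_le_mul_of_nonneg_right h1 (Real.exp_pos _).le
      _ ≤ (40 / A₁ * Q * E * Real.exp x) * Real.exp Y :=
          mul_le_mul_of_nonneg_right (mul_le_mul_of_nonneg_left h2 (by positivity))
            (Real.exp_pos _).le
  have h4 : 40 / A₁ * Q * E * Real.exp x * Real.exp Y =
      40 / A₁ * Q * Real.exp (κ * Tmax * (1 - P') / (1 - r) + x + Y) := by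
    rw [Real.exp_add, Real.exp_add, hE]; ring
  rw [h4] at h3
  refine h3.trans (mul_le_mul_of_nonneg_left (Real.exp_le_exp.mpr ?_) hc0)
  have h5 : x + Y ≤ κ * (P' * Tmax) := by
    have h6 : x + Y ≤ κ * (P₁ * T) := by rw [hx, hκ]; nlinarith
    have h7 : P₁ * T ≤ P' * Tmax := mul_le_mul hP₁ hT hT0 (hP₁0.trans hP₁)
    nlinarith
  have hr' : 1 - r ≠ 0 := by linarith
  have h8 : κ * Tmax * (1 - P') / (1 - r) + κ * (P' * Tmax) = κ * Tmax * (1 - P) / (1 - r) := by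
    rw [← hrP]; field_simp; ring
  linarith

/-- **INTO, trail part.** At a section time `T ≤ Tmax`, from the outputs of `into_trail_apply` at `T`,
the trail data, the carrier-flux smallness `K Tmax ≤ 13 (1 - r)` and the spent active pair
`|a 0 (T)| ≤ 13`, `0 ≤ b 0 (T) ≤ 31/A`: every renormalised mode `q · (mode n+1)`, `n ≤ -1`, lies in the
trail box of scale `n`. [folklore] -/
theorem into_trail :
    ∀ (lam q r ε A₁ A T Tmax K κ : ℝ) (a b : ℤ → ℝ → ℝ), 1 < lam → q = lam ^ (1 / 5 : ℝ) →
    r = lam ^ (-(4 / 5 : ℝ)) → 0 ≤ ε → 0 < A₁ → A₁ ≤ A → 0 ≤ T → T ≤ Tmax →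
    κ = 65 + 169 / 10 * ε * A₁ → 0 ≤ K → K * Tmax ≤ 13 * (1 - r) →
    (∀ n : ℤ, n ≤ -1 →
      |a n 0| ≤ 13 * lam ^ (-(n : ℝ) / 5) * (2 - lam ^ ((4 / 5 : ℝ) * n)) ∧
      b n 0 ≤ 40 / A₁ * lam ^ (-(n : ℝ) / 5) *
        Real.exp (κ * Tmax * (1 - lam ^ ((4 / 5 : ℝ) * (n + 1))) / (1 - r))) →
    (∀ j : ℕ, 1 ≤ j → 0 ≤ b (-(j : ℤ)) T ∧
      b (-(j : ℤ)) T ≤ (b (-(j : ℤ)) 0 + 4 * ε * 169 * lam ^ ((j : ℝ) / 5) * T) * Real.exp (65 * T) ∧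
      |a (-(j : ℤ)) T| ≤ |a (-(j : ℤ)) 0| + K * lam ^ ((j : ℝ) / 5) * lam ^ (-(4 / 5 : ℝ) * j) * T) →
    (∀ j : ℕ, 2 ≤ j → b (-(j : ℤ)) T ≤ (b (-(j : ℤ)) 0 +
      4 * ε * 169 * lam ^ ((j : ℝ) / 5) * lam ^ (-(4 / 5 : ℝ) * j) * T) *
        Real.exp (52 * lam ^ (-(4 / 5 : ℝ) * j) * T)) →
    |a 0 T| ≤ 13 → 0 ≤ b 0 T → b 0 T ≤ 31 / A →
    ∀ n : ℤ, n ≤ -1 →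
      |q * a (n + 1) T| ≤ 13 * lam ^ (-(n : ℝ) / 5) * (2 - lam ^ ((4 / 5 : ℝ) * n)) ∧
      0 ≤ q * b (n + 1) T ∧ q * b (n + 1) T ≤ 40 / A₁ * lam ^ (-(n : ℝ) / 5) *
        Real.exp (κ * Tmax * (1 - lam ^ ((4 / 5 : ℝ) * (n + 1))) / (1 - r)) := by
  intro lam q r ε A₁ A T Tmax K κ a b hlam hq hr hε hA₁ hA₁A hT0 hTT hκ hK0 hK htrail hbj hbdj hu hv0 hv
    n hn
  have hlam0 : 0 < lam := by linarith
  have hq0 : 0 < q := by rw [hq]; positivity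
  have hr0 : 0 < r := by rw [hr]; positivity
  have hr1 : r < 1 := by rw [hr]; exact Real.rpow_lt_one_of_one_lt_of_neg hlam (by norm_num)
  have hA0 : 0 < A := hA₁.trans_le hA₁A
  rcases eq_or_lt_of_le hn with rfl | hn2
  · -- the spent active pair
    have e1 : lam ^ (-((-1 : ℤ) : ℝ) / 5) = q := by rw [hq]; norm_num
    have e2 : lam ^ ((4 / 5 : ℝ) * ((-1 : ℤ) : ℝ)) = r := by rw [hr]; norm_num
    have e3 : Real.exp (κ * Tmax * (1 - lam ^ ((4 / 5 : ℝ) * (((-1 : ℤ) : ℝ) + 1))) / (1 - r)) = 1 := by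
      norm_num
    have e4 : ((-1 : ℤ) + 1) = 0 := by norm_num
    rw [e1, e2, e3, e4]
    refine ⟨?_, mul_nonneg hq0.le hv0, ?_⟩
    · rw [abs_mul, abs_of_pos hq0]
      have h1 : q * |a 0 T| ≤ q * 13 := mul_le_mul_of_nonneg_left hu hq0.le
      have h2 : q * 13 * 1 ≤ q * 13 * (2 - r) :=
        mul_le_mul_of_nonneg_left (by linarith) (by positivity)
      linarith
    · have h1 : 31 / A ≤ 40 / A₁ := by
        rw [div_le_div_iff₀ hA0 hA₁]; linarith
      have h2 : q * b 0 T ≤ q * (40 / A₁) := mul_le_mul_of_nonneg_left (hv.trans h1) hq0.le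
      linarith
  · -- the trail proper: mode `n + 1 = -j`, `j ≥ 1`
    obtain ⟨j, hj⟩ := Int.exists_eq_neg_ofNat (show n + 1 ≤ 0 by omega)
    have hj1 : 1 ≤ j := by omega
    have hj1' : (1 : ℝ) ≤ j := by exact_mod_cast hj1
    have hnj : (n : ℝ) = -(j : ℝ) - 1 := by
      have : n = -(j : ℤ) - 1 := by omega
      rw [this]; push_cast; ring
    obtain ⟨hda, hdb⟩ := htrail (-(j : ℤ)) (by omega)
    have e1 : (-((-(j : ℤ) : ℤ) : ℝ) / 5) = (j : ℝ) / 5 := by push_cast; ring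
    have e2 : (4 / 5 : ℝ) * ((-(j : ℤ) : ℤ) : ℝ) = -(4 / 5 : ℝ) * j := by push_cast; ring
    have e3 : (4 / 5 : ℝ) * (((-(j : ℤ) : ℤ) : ℝ) + 1) = -(4 / 5 : ℝ) * ((j : ℝ) - 1) := by
      push_cast; ring
    rw [e1, e2] at hda
    rw [e1, e3] at hdb
    obtain ⟨hbT0, hbT, haT⟩ := hbj j hj1
    have hbd : 2 ≤ j → b (-(j : ℤ)) T ≤ (b (-(j : ℤ)) 0 +
        4 * ε * 169 * lam ^ ((j : ℝ) / 5) * lam ^ (-(4 / 5 : ℝ) * j) * T) *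
          Real.exp (52 * lam ^ (-(4 / 5 : ℝ) * j) * T) := fun h => hbdj j h
    have E1 : lam ^ (-(n : ℝ) / 5) = lam ^ ((j : ℝ) / 5) * q := by
      rw [hnj, hq, ← Real.rpow_add hlam0]; congr 1; ring
    have E2 : lam ^ ((4 / 5 : ℝ) * (n : ℝ)) = lam ^ (-(4 / 5 : ℝ) * j) * r := by
      rw [hnj, hr, ← Real.rpow_add hlam0]; congr 1; ring
    have E3 : lam ^ ((4 / 5 : ℝ) * ((n : ℝ) + 1)) = lam ^ (-(4 / 5 : ℝ) * j) := by
      rw [hnj]; congr 1; ring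
    rw [hj, E1, E2, E3]
    set Q := lam ^ ((j : ℝ) / 5) with hQ
    set P := lam ^ (-(4 / 5 : ℝ) * j) with hP
    set P' := lam ^ (-(4 / 5 : ℝ) * ((j : ℝ) - 1)) with hP'
    have hQ0 : 0 < Q := by positivity
    have hP0 : 0 < P := by positivity
    have hPP' : P ≤ P' := Real.rpow_le_rpow_of_exponent_le hlam.le (by linarith)
    have hP'1 : P' ≤ 1 := Real.rpow_le_one_of_one_le_of_nonpos hlam.le (by linarith)
    have hrP : r * P' = P := by rw [hr, hP', hP, ← Real.rpow_add hlam0]; congr 1; ring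
    refine ⟨?_, mul_nonneg hq0.le hbT0, ?_⟩
    · have hKT : K * Q * P * T ≤ 13 * (1 - r) * (Q * P) := by
        have h1 : K * T ≤ 13 * (1 - r) := (mul_le_mul_of_nonneg_left hTT hK0).trans hK
        have h2 := mul_le_mul_of_nonneg_right h1 (mul_pos hQ0 hP0).le
        linarith [show K * Q * P * T = K * T * (Q * P) by ring]
      rw [abs_mul, abs_of_pos hq0]
      calc q * |a (-(j : ℤ)) T| ≤ q * (13 * Q * (2 - P) + 13 * (1 - r) * (Q * P)) :=
            mul_le_mul_of_nonneg_left (haT.trans (add_le_add hda hKT)) hq0.le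
        _ = 13 * (Q * q) * (2 - P * r) := by ring
    · have key : b (-(j : ℤ)) T ≤ 40 / A₁ * Q * Real.exp (κ * Tmax * (1 - P) / (1 - r)) := by
        rcases eq_or_lt_of_le hj1 with hj1e | hj2
        · have hP'e : P' = 1 := by rw [hP', ← hj1e]; norm_num
          exact into_pt_bond (P₁ := 1) hA₁ hε hQ0.le zero_le_one (by rw [hP'e]) hP'1 hrP hr1 hT0
            hTT hκ (le_of_eq (by ring)) (le_of_eq (by ring)) hbT hdb
        · exact into_pt_bond hA₁ hε hQ0.le hP0.le hPP' hP'1 hrP hr1 hT0 hTT hκ le_rfl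
            (by linarith [mul_nonneg hP0.le hT0]) (hbd hj2) hdb
      calc q * b (-(j : ℤ)) T ≤ q * (40 / A₁ * Q * Real.exp (κ * Tmax * (1 - P) / (1 - r))) :=
            mul_le_mul_of_nonneg_left key hq0.le
        _ = 40 / A₁ * (Q * q) * Real.exp (κ * Tmax * (1 - P) / (1 - r)) := by ring

/-- **INTO, precursor part.** At a section time `T ≤ Tmax ≤ 1/8`, from the outputs of the precursor
tower at `T` (with `β = ε^{3/2}`), the precursor data and the flux budget
`q (ε²/(4 lam²) + lam Zs² Tmax + 28 ε³ Tmax) ≤ ε^{3/4}`: the renormalised scale-2 pair lies in the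
active box of scale 1, and every renormalised precursor `q · (mode n+1)`, `n ≥ 2`, lies in the
precursor box of scale `n` (`(2 lam)^{-(n+1)} ≤ (2 lam)^{-n}/2`, `q ≤ 1.09`). [folklore] -/
theorem into_prec {lam q ε T Tmax Zs : ℝ} {a b : ℤ → ℝ → ℝ} (hlam : 1 < lam) (hlam2 : lam ≤ 3 / 2)
    (hq : q = lam ^ (1 / 5 : ℝ)) (hε : 0 < ε) (hε1 : ε ≤ 1 / 100000) (hT0 : 0 ≤ T) (hTT : T ≤ Tmax)
    (hTmax : Tmax ≤ 1 / 8)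
    (HS6 : q * (ε ^ 2 / (4 * lam ^ 2) + lam * Zs ^ 2 * Tmax + 28 * ε ^ 3 * Tmax) ≤ ε ^ (3 / 4 : ℝ))
    (hpre : ∀ n : ℤ, 2 ≤ n → |a n 0| ≤ ε ^ 2 * (2 * lam) ^ (-(n : ℝ)) ∧
      b n 0 ≤ ε ^ (3 / 2 : ℝ) * (2 * lam) ^ (-(n : ℝ)))
    (htow : ∀ n : ℤ, 2 ≤ n → 0 ≤ b n T ∧
      b n T ≤ max (b n 0) (ε ^ (3 / 2 : ℝ) * lam ^ ((n : ℝ) / 5) * (2 * lam) ^ (-(2 * (n : ℝ)))) ∧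
      |a n T| ≤ |a n 0| + (if n = 2 then lam * Zs ^ 2 * T else 0) +
        28 * ε ^ 3 * (2 * lam) ^ (-(n : ℝ)) * T ∧
      -|a n 0| - 28 * ε ^ 3 * (2 * lam) ^ (-(n : ℝ)) * T ≤ a n T) :
    (-ε ^ 2 ≤ q * a 2 T ∧ q * a 2 T ≤ ε ^ (3 / 4 : ℝ) ∧ 0 ≤ q * b 2 T ∧
      q * b 2 T ≤ ε ^ (3 / 2 : ℝ)) ∧
    (∀ n : ℤ, 2 ≤ n → |q * a (n + 1) T| ≤ ε ^ 2 * (2 * lam) ^ (-(n : ℝ)) ∧ 0 ≤ q * b (n + 1) T ∧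
      q * b (n + 1) T ≤ ε ^ (3 / 2 : ℝ) * (2 * lam) ^ (-(n : ℝ))) := by
  obtain ⟨-, -, hq1, hq2, -, -, -⟩ := activeClock_consts hlam hlam2 rfl hq
  have hlam0 : 0 < lam := by linarith
  have hq0 : 0 < q := by linarith
  have hε2 : 0 ≤ ε ^ 2 := by positivity
  have hβ0 : 0 ≤ ε ^ (3 / 2 : ℝ) := by positivity
  have h28 : 1 + 28 * ε * T ≤ 1001 / 1000 := by
    have := mul_le_mul hε1 (hTT.trans hTmax) hT0 (by norm_num)
    linarith
  have hq11 : q * (1 + 28 * ε * T) ≤ 11 / 10 := by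
    have := mul_le_mul hq2 h28 (by positivity) (by norm_num)
    linarith
  -- every precursor bond is below its box at time `T`
  have hbnd : ∀ n : ℤ, 2 ≤ n → 0 ≤ b n T ∧ b n T ≤ ε ^ (3 / 2 : ℝ) * (2 * lam) ^ (-(n : ℝ)) := by
    intro n hn
    obtain ⟨hb0T, hbmax, -, -⟩ := htow n hn
    obtain ⟨-, -, -, F4, F5, -⟩ := precursor_rpow_facts (x := (n : ℝ)) hlam (by exact_mod_cast hn)
    refine ⟨hb0T, hbmax.trans (max_le (hpre n hn).2 ?_)⟩
    rw [F4]
    have hR0 : 0 ≤ (2 * lam) ^ (-(n : ℝ)) := by positivity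
    calc ε ^ (3 / 2 : ℝ) * lam ^ ((n : ℝ) / 5) * ((2 * lam) ^ (-(n : ℝ)) * (2 * lam) ^ (-(n : ℝ)))
        = ε ^ (3 / 2 : ℝ) * (2 * lam) ^ (-(n : ℝ)) * (lam ^ ((n : ℝ) / 5) * (2 * lam) ^ (-(n : ℝ))) := by
          ring
      _ ≤ ε ^ (3 / 2 : ℝ) * (2 * lam) ^ (-(n : ℝ)) * 1 :=
          mul_le_mul_of_nonneg_left F5 (mul_nonneg hβ0 hR0)
      _ = ε ^ (3 / 2 : ℝ) * (2 * lam) ^ (-(n : ℝ)) := mul_one _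
  constructor
  · obtain ⟨-, -, ha2, ha2lo⟩ := htow 2 le_rfl
    obtain ⟨hb2T, hb2⟩ := hbnd 2 le_rfl
    have hda := (hpre 2 le_rfl).1
    rw [if_pos rfl] at ha2
    have e2 : (2 * lam) ^ (-((2 : ℤ) : ℝ)) = (4 * lam ^ 2)⁻¹ := by
      rw [show (-((2 : ℤ) : ℝ)) = -(2 : ℝ) by norm_num, Real.rpow_neg (by positivity), Real.rpow_two]
      ring
    rw [e2] at ha2 ha2lo hb2 hda
    have hR0 : 0 < (4 * lam ^ 2)⁻¹ := by positivity
    have hR4 : (4 * lam ^ 2)⁻¹ ≤ 4⁻¹ := inv_anti₀ (by norm_num) (by nlinarith)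
    have hR1 : (4 * lam ^ 2)⁻¹ ≤ 1 := by linarith
    refine ⟨?_, ?_, mul_nonneg hq0.le hb2T, ?_⟩
    · have h1 : -(ε ^ 2 * (4 * lam ^ 2)⁻¹ * (1 + 28 * ε * T)) ≤ a 2 T := by
        linarith [show ε ^ 2 * (4 * lam ^ 2)⁻¹ * (1 + 28 * ε * T) =
          ε ^ 2 * (4 * lam ^ 2)⁻¹ + 28 * ε ^ 3 * (4 * lam ^ 2)⁻¹ * T by ring]
      have h2 : q * (ε ^ 2 * (4 * lam ^ 2)⁻¹ * (1 + 28 * ε * T)) ≤ ε ^ 2 := by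
        calc q * (ε ^ 2 * (4 * lam ^ 2)⁻¹ * (1 + 28 * ε * T))
            = ε ^ 2 * (q * (1 + 28 * ε * T)) * (4 * lam ^ 2)⁻¹ := by ring
          _ ≤ ε ^ 2 * (11 / 10) * 4⁻¹ :=
              mul_le_mul (mul_le_mul_of_nonneg_left hq11 hε2) hR4 hR0.le (by positivity)
          _ ≤ ε ^ 2 := by linarith
      have h3 := mul_le_mul_of_nonneg_left h1 hq0.le
      linarith
    · have h1 : |a 2 T| ≤ ε ^ 2 / (4 * lam ^ 2) + lam * Zs ^ 2 * Tmax + 28 * ε ^ 3 * Tmax := by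
        have t2 : lam * Zs ^ 2 * T ≤ lam * Zs ^ 2 * Tmax :=
          mul_le_mul_of_nonneg_left hTT (by positivity)
        have t3 : 28 * ε ^ 3 * (4 * lam ^ 2)⁻¹ * T ≤ 28 * ε ^ 3 * Tmax := by
          calc 28 * ε ^ 3 * (4 * lam ^ 2)⁻¹ * T ≤ 28 * ε ^ 3 * 1 * Tmax :=
                mul_le_mul (mul_le_mul_of_nonneg_left hR1 (by positivity)) hTT hT0 (by positivity)
            _ = 28 * ε ^ 3 * Tmax := by ring
        have t1 : ε ^ 2 * (4 * lam ^ 2)⁻¹ = ε ^ 2 / (4 * lam ^ 2) := (div_eq_mul_inv _ _).symm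
        linarith
      calc q * a 2 T ≤ q * |a 2 T| := mul_le_mul_of_nonneg_left (le_abs_self _) hq0.le
        _ ≤ q * (ε ^ 2 / (4 * lam ^ 2) + lam * Zs ^ 2 * Tmax + 28 * ε ^ 3 * Tmax) :=
            mul_le_mul_of_nonneg_left h1 hq0.le
        _ ≤ ε ^ (3 / 4 : ℝ) := HS6
    · have hq4 : q * (4 * lam ^ 2)⁻¹ ≤ 1 := by
        have := mul_le_mul hq2 hR4 hR0.le (by norm_num)
        linarith
      calc q * b 2 T ≤ q * (ε ^ (3 / 2 : ℝ) * (4 * lam ^ 2)⁻¹) := mul_le_mul_of_nonneg_left hb2 hq0.le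
        _ = ε ^ (3 / 2 : ℝ) * (q * (4 * lam ^ 2)⁻¹) := by ring
        _ ≤ ε ^ (3 / 2 : ℝ) * 1 := mul_le_mul_of_nonneg_left hq4 hβ0
        _ = ε ^ (3 / 2 : ℝ) := mul_one _
  · intro n hn
    have hn1 : 2 ≤ n + 1 := by omega
    obtain ⟨-, -, haT, -⟩ := htow (n + 1) hn1
    obtain ⟨hbT0, hbT⟩ := hbnd (n + 1) hn1
    have hda := (hpre (n + 1) hn1).1
    rw [if_neg (by omega)] at haT
    obtain ⟨-, -, -, -, -, -, -, F8⟩ := precursor_rpow_facts (x := (n : ℝ)) hlam (by exact_mod_cast hn)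
    have ecast : ((n + 1 : ℤ) : ℝ) = (n : ℝ) + 1 := by push_cast; ring
    rw [ecast] at haT hbT hda
    have hR0 : 0 ≤ (2 * lam) ^ (-(n : ℝ)) := by positivity
    have hR10 : 0 ≤ (2 * lam) ^ (-((n : ℝ) + 1)) := by positivity
    refine ⟨?_, mul_nonneg hq0.le hbT0, ?_⟩
    · rw [abs_mul, abs_of_pos hq0]
      have h1 : |a (n + 1) T| ≤ ε ^ 2 * (2 * lam) ^ (-((n : ℝ) + 1)) * (1 + 28 * ε * T) := by
        linarith [show ε ^ 2 * (2 * lam) ^ (-((n : ℝ) + 1)) * (1 + 28 * ε * T) =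
          ε ^ 2 * (2 * lam) ^ (-((n : ℝ) + 1)) + 28 * ε ^ 3 * (2 * lam) ^ (-((n : ℝ) + 1)) * T by ring]
      calc q * |a (n + 1) T| ≤ q * (ε ^ 2 * (2 * lam) ^ (-((n : ℝ) + 1)) * (1 + 28 * ε * T)) :=
            mul_le_mul_of_nonneg_left h1 hq0.le
        _ = ε ^ 2 * (q * (1 + 28 * ε * T)) * (2 * lam) ^ (-((n : ℝ) + 1)) := by ring
        _ ≤ ε ^ 2 * (11 / 10) * ((2 * lam) ^ (-(n : ℝ)) / 2) :=
            mul_le_mul (mul_le_mul_of_nonneg_left hq11 hε2) F8 hR10 (by positivity)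
        _ ≤ ε ^ 2 * (2 * lam) ^ (-(n : ℝ)) := by linarith [mul_nonneg hε2 hR0]
    · calc q * b (n + 1) T ≤ q * (ε ^ (3 / 2 : ℝ) * (2 * lam) ^ (-((n : ℝ) + 1))) :=
            mul_le_mul_of_nonneg_left hbT hq0.le
        _ ≤ q * (ε ^ (3 / 2 : ℝ) * ((2 * lam) ^ (-(n : ℝ)) / 2)) :=
            mul_le_mul_of_nonneg_left (mul_le_mul_of_nonneg_left F8 hβ0) hq0.le
        _ = ε ^ (3 / 2 : ℝ) * (2 * lam) ^ (-(n : ℝ)) * (q / 2) := by ring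
        _ ≤ ε ^ (3 / 2 : ℝ) * (2 * lam) ^ (-(n : ℝ)) * 1 :=
            mul_le_mul_of_nonneg_left (by linarith) (mul_nonneg hβ0 hR0)
        _ = ε ^ (3 / 2 : ℝ) * (2 * lam) ^ (-(n : ℝ)) := mul_one _

end Summit.NavierStokesRegularity.NavierStokesRegularity.Theorems.PerpetualPumpCircuitPump
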